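import Summits.QuantumFields.YangMills.Theorems.AllWindowsColdBoxBoxHighLineTiltCum5Bound

/-!
# U5-L3c, generic layer: the fifth tilted cumulant over `μ_D` through restricted Gaussian moments (norm transfer)

Continuation of ✓`…TiltCum5Bound` (U5-L3b, `Tilt.abs_tiltCum5_le_of_moments`) in the pattern of w5 g22's ✓`Tilt.abs_tiltCum4_muD_le`
(✓`…TiltCumulantBounds`): over `μ_D := (volume.restrict (smallField H s)).withDensity (ofReal ∘ gaussWeight β H)` and along the tilt by a `U` with
`|U| ≤ B` on `smallField H s`, every constant-centred tilted moment is at most `e^{2tB}` times the restricted Gaussian ratio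
`R(Y) := gaussAvg β H (sfInd·Y) / gaussAvg β H (sfInd)` (✓`Tilt.tiltExp_muD_le_gaussAvg`, LEAD sfw-p2 g77's T-S5.13n); substituting the seven moments
`(G₁−a₁)², (G₂−a₂)², (G₁−a₁)⁴, (G₂−a₂)⁴, (U−b)², (U−b)⁴, (U−b)⁶` gives

* ★★ **`Tilt.abs_tiltCum5_muD_le`** — `|κ₅,t(G₁,G₂,U,U,U)|` over `μ_D`, uniformly usable for `t ∈ [0,1]`, by `gaussAvg`-letters only: the `hK`-type input of
  ✓`tiltThirdOrder` (U5-L3a) for the recorded lift L3 («f‴ = κ₅,t by Cauchy–Schwarz + norm transfer») of planner ym-idea-2 g18's `U5-BLOCKERS.md` §2.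

The Gaussian sizes of the seven ratios (✓12b/12c/12e, w5 g23's ✓`EdgeChartGaussian.gaussAvg_pow_even_le_of_polyCert`, ✓13K-U/K3/K4 slot technology) are the
consumer's business.  Tree + Mathlib; no definitions; standard axioms.
HONEST LABEL: U5 prep, helper; U5 ⟨stmt-QuantumFields-24336⟩, ⟨24004⟩ OPEN; route AllWindowsColdBox DRAFT; the Yang–Mills mass gap is NOT proved by this file;
no summit is proved by a line.  Seat ym-line-fcl-p3 g26.
-/

set_option autoImplicit false

noncomputable section

open MeasureTheory Set
open Summit.QuantumFields.YangMills.Cruxes.NT.SkewResponse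

namespace Summit.QuantumFields.YangMills.Theorems.AllWindowsColdBoxBoxHighLine

namespace Tilt

/-- ★★ **`κ₅,t` over `μ_D` through restricted Gaussian moments**: with `E = e^{2tB}` (`|U| ≤ B` on `smallField H s`, `0 ≤ t`) and
`R(Y) = gaussAvg β H (sfInd·Y)/gaussAvg β H (sfInd)`, for all constants `a₁, a₂, b`, `|κ₅,t(G₁,G₂,U,U,U)|` is at most the bound of
✓`abs_tiltCum5_le_of_moments` evaluated at `mᵢ := E·R((Gᵢ−aᵢ)²)`, `qᵢ := E·R((Gᵢ−aᵢ)⁴)`, `u_k := E·R((U−b)^k)` (`k = 2,4,6`)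
(globally bounded measurable `U, G₁, G₂`). -/
theorem abs_tiltCum5_muD_le (H : ℕ) {β : ℝ} (hβ : 0 < β) {s : ℝ} (hD : 0 < ∫ a, sfInd H s a * gaussWeight β H a)
    {U G₁ G₂ : (LandauFree H → E3) → ℝ} {BU B₁ B₂ B : ℝ} (hU : Measurable U) (h₁ : Measurable G₁) (h₂ : Measurable G₂)
    (hUb : ∀ a, |U a| ≤ BU) (h₁b : ∀ a, |G₁ a| ≤ B₁) (h₂b : ∀ a, |G₂ a| ≤ B₂) (hUD : ∀ a ∈ smallField H s, |U a| ≤ B)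
    {t : ℝ} (ht : 0 ≤ t) (a₁ a₂ b : ℝ) :
    |tiltCum5 ((volume.restrict (smallField H s)).withDensity fun a => ENNReal.ofReal (gaussWeight β H a)) U t G₁ G₂| ≤
      Real.sqrt (Real.sqrt (16 * (Real.exp (2 * t * B) *
              (gaussAvg β H (fun a => sfInd H s a * (G₁ a - a₁) ^ 4) / gaussAvg β H (sfInd H s)))) *
            Real.sqrt (16 * (Real.exp (2 * t * B) *
              (gaussAvg β H (fun a => sfInd H s a * (G₂ a - a₂) ^ 4) / gaussAvg β H (sfInd H s))))) *
          Real.sqrt (64 * (Real.exp (2 * t * B) *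
            (gaussAvg β H (fun a => sfInd H s a * (U a - b) ^ 6) / gaussAvg β H (sfInd H s)))) +
        Real.sqrt (Real.exp (2 * t * B) * (gaussAvg β H (fun a => sfInd H s a * (G₁ a - a₁) ^ 2) / gaussAvg β H (sfInd H s))) *
            Real.sqrt (Real.exp (2 * t * B) * (gaussAvg β H (fun a => sfInd H s a * (G₂ a - a₂) ^ 2) / gaussAvg β H (sfInd H s))) *
          (Real.sqrt (Real.exp (2 * t * B) * (gaussAvg β H (fun a => sfInd H s a * (U a - b) ^ 2) / gaussAvg β H (sfInd H s))) *
            Real.sqrt (16 * (Real.exp (2 * t * B) *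
              (gaussAvg β H (fun a => sfInd H s a * (U a - b) ^ 4) / gaussAvg β H (sfInd H s))))) +
        3 * (Real.sqrt (Real.exp (2 * t * B) * (gaussAvg β H (fun a => sfInd H s a * (G₁ a - a₁) ^ 2) / gaussAvg β H (sfInd H s))) *
              Real.sqrt (Real.exp (2 * t * B) * (gaussAvg β H (fun a => sfInd H s a * (U a - b) ^ 2) / gaussAvg β H (sfInd H s))) *
            (Real.sqrt (Real.exp (2 * t * B) * (gaussAvg β H (fun a => sfInd H s a * (G₂ a - a₂) ^ 2) / gaussAvg β H (sfInd H s))) *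
              Real.sqrt (16 * (Real.exp (2 * t * B) *
                (gaussAvg β H (fun a => sfInd H s a * (U a - b) ^ 4) / gaussAvg β H (sfInd H s)))))) +
        3 * (Real.sqrt (Real.exp (2 * t * B) * (gaussAvg β H (fun a => sfInd H s a * (G₂ a - a₂) ^ 2) / gaussAvg β H (sfInd H s))) *
              Real.sqrt (Real.exp (2 * t * B) * (gaussAvg β H (fun a => sfInd H s a * (U a - b) ^ 2) / gaussAvg β H (sfInd H s))) *
            (Real.sqrt (Real.exp (2 * t * B) * (gaussAvg β H (fun a => sfInd H s a * (G₁ a - a₁) ^ 2) / gaussAvg β H (sfInd H s))) *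
              Real.sqrt (16 * (Real.exp (2 * t * B) *
                (gaussAvg β H (fun a => sfInd H s a * (U a - b) ^ 4) / gaussAvg β H (sfInd H s)))))) +
        3 * (Real.exp (2 * t * B) * (gaussAvg β H (fun a => sfInd H s a * (U a - b) ^ 2) / gaussAvg β H (sfInd H s)) *
            (Real.sqrt (Real.sqrt (16 * (Real.exp (2 * t * B) *
                    (gaussAvg β H (fun a => sfInd H s a * (G₁ a - a₁) ^ 4) / gaussAvg β H (sfInd H s)))) *
                  Real.sqrt (16 * (Real.exp (2 * t * B) *
                    (gaussAvg β H (fun a => sfInd H s a * (G₂ a - a₂) ^ 4) / gaussAvg β H (sfInd H s))))) *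
              Real.sqrt (Real.exp (2 * t * B) *
                (gaussAvg β H (fun a => sfInd H s a * (U a - b) ^ 2) / gaussAvg β H (sfInd H s))))) := by
  haveI := isFiniteMeasure_muD H hβ s
  haveI := neZero_muD H hβ hD
  -- the seven constant-centred observables: measurable, bounded, nonnegative
  have c₁ : ∀ a, |G₁ a - a₁| ≤ B₁ + |a₁| := fun a => (abs_sub _ _).trans (add_le_add (h₁b a) le_rfl)
  have c₂ : ∀ a, |G₂ a - a₂| ≤ B₂ + |a₂| := fun a => (abs_sub _ _).trans (add_le_add (h₂b a) le_rfl)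
  have cU : ∀ a, |U a - b| ≤ BU + |b| := fun a => (abs_sub _ _).trans (add_le_add (hUb a) le_rfl)
  have hm₁ : Measurable fun a => G₁ a - a₁ := h₁.sub measurable_const
  have hm₂ : Measurable fun a => G₂ a - a₂ := h₂.sub measurable_const
  have hmU : Measurable fun a => U a - b := hU.sub measurable_const
  have e6 : ∀ a, 0 ≤ (U a - b) ^ 6 := fun a => by positivity
  have e4U : ∀ a, 0 ≤ (U a - b) ^ 4 := fun a => by positivity
  have e4₁ : ∀ a, 0 ≤ (G₁ a - a₁) ^ 4 := fun a => by positivity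
  have e4₂ : ∀ a, 0 ≤ (G₂ a - a₂) ^ 4 := fun a => by positivity
  -- norm transfer for each of them
  have t₁ := tiltExp_muD_le_gaussAvg H hβ hD ht hU hUD (fun a => sq_nonneg (G₁ a - a₁))
    (integrable_bdd_mul_gaussWeight H hβ (hm₁.pow_const 2) (abs_pow_le_pow c₁ 2))
  have t₂ := tiltExp_muD_le_gaussAvg H hβ hD ht hU hUD (fun a => sq_nonneg (G₂ a - a₂))
    (integrable_bdd_mul_gaussWeight H hβ (hm₂.pow_const 2) (abs_pow_le_pow c₂ 2))
  have q₁ := tiltExp_muD_le_gaussAvg H hβ hD ht hU hUD (fun a => e4₁ a)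
    (integrable_bdd_mul_gaussWeight H hβ (hm₁.pow_const 4) (abs_pow_le_pow c₁ 4))
  have q₂ := tiltExp_muD_le_gaussAvg H hβ hD ht hU hUD (fun a => e4₂ a)
    (integrable_bdd_mul_gaussWeight H hβ (hm₂.pow_const 4) (abs_pow_le_pow c₂ 4))
  have u₂ := tiltExp_muD_le_gaussAvg H hβ hD ht hU hUD (fun a => sq_nonneg (U a - b))
    (integrable_bdd_mul_gaussWeight H hβ (hmU.pow_const 2) (abs_pow_le_pow cU 2))
  have u₄ := tiltExp_muD_le_gaussAvg H hβ hD ht hU hUD (fun a => e4U a)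
    (integrable_bdd_mul_gaussWeight H hβ (hmU.pow_const 4) (abs_pow_le_pow cU 4))
  have u₆ := tiltExp_muD_le_gaussAvg H hβ hD ht hU hUD (fun a => e6 a)
    (integrable_bdd_mul_gaussWeight H hβ (hmU.pow_const 6) (abs_pow_le_pow cU 6))
  exact abs_tiltCum5_le_of_moments hU h₁ h₂ hUb h₁b h₂b t a₁ a₂ b t₁ t₂ q₁ q₂ u₂ u₄ u₆

end Tilt

end Summit.QuantumFields.YangMills.Theorems.AllWindowsColdBoxBoxHighLine

end
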